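import Summits.BirchSwinnertonDyer.BirchSwinnertonDyer.Theorems.ErratumRoadFiveNonSurjCornerBranchesDefs
import Summits.BirchSwinnertonDyer.Rank1Residual.X11a.Cells
import Literature.NumberTheory.EllipticCurves.CuspFormLFunction
import HarnessLib

/-!
# Route `ErratumRoadFive` (rung K2), crux `NonSurjCorner` (item stmt-BirchSwinnertonDyer-19065): the TWO DEEP CHILDREN of the phase-1b re-split in
# SHAPE B (RULING 68), as Theses-free `Prop` constants so the route file can type them BY NAME — `NonSurjCornerKolyZDeep`,
# `NonSurjCornerTwinMuAnDeep` (the third child, the fifteen-fact bundle `KatoTwinFactsFiveAnContra`, stays a route-file conjunction)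
# (cell `bsd-stepL`, seat `bsd-stepL-corner-p1` g18; planner g41 RULING 68 (b), STATUS 2026-08-28T15:11:57Z; `--supports stmt-BirchSwinnertonDyer-19065`)

This module imports NO Theses file (pattern of `ErratumRoadFiveNonSurjCornerBranchesDefs.lean`, g6): `Theses/ErratumRoadFive.lean` may import it, so the
planner's `route edit --resplit NonSurjCorner --into {NonSurjCornerKolyZDeep, NonSurjCornerTwinMuAnDeep, KatoTwinFactsFiveAnContra, NonSurjCornerLowerX11a}`
types the two DEEP children BY NAME as the constants below; the third child `KatoTwinFactsFiveAnContra` (the fifteen named facts) is NOT declared here —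
like `PublishedInputsFive` ∕ `KatoTwinFactsFiveAn` it is a route-file CONJUNCTION whose text the planner pastes as the support child's statement (pattern and
reason of `…NonSurjCornerBranchesDefs`: a bundle of existing Literature facts declared as a cited `def … : Prop` inside Summits is relocated ∕ audited as a
vendored fact; text = binder 3 of `nonSurjCornerOfItemsDeep_holds`, = binder `hF` of p639164, ws-identical, planner-checked in RULING 67 (c)). The generated
glue `NonSurjCornerOfItems : NonSurjCornerKolyZDeep → NonSurjCornerTwinMuAnDeep → KatoTwinFactsFiveAnContra → NonSurjCornerLowerX11a → NonSurjCorner` is then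
proved modulo the top-level items by the one-liner over this seat's landed `nonSurjCornerOfItemsDeep_holds` (`Theorems/ErratumRoadFiveNonSurjCornerHybridTwinMuAnDeep.lean`,
p642519), whose displayed binders are these texts VERBATIM (so the one-liner elaborates by `δ`-unfolding).

THE TEXTS.
* **`NonSurjCornerKolyZDeep`** = r14–r18 slot 1 `stub_kolyZShaAnDeep57` VERBATIM: refined-Kolyvagin certificates `∃ M ≤ t, CertificateAt Dt β ι p M` asked
  ONLY at the corner pairs whose analytic Ш has positive `p`-valuation (`#Ш(E)_an = s`, `0 < ord_p s`) and ONLY at the DEEP frames (a conductor-1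
  Kolyvagin–Heegner datum whose bottom point lies in `p^{t+1}E(K)`) — the `Ш_an`-cut of `NonSurjCornerKolyZ` (19946), which implies it a fortiori (g14).
* **`NonSurjCornerTwinMuAnDeep`** = clause (2b) of r18 (= binder `hμD` of glue #20, p642519) VERBATIM: `NonSurjCornerTwinMuAn`'s (19948) allowable-root
  clause asked ONLY at the Friedberg–Hoffstein twin models `Wd = Cd • E^{(d_K)}` (`K` imaginary quadratic, Heegner for `N_E`, `L(E^{(d_K)},1) ≠ 0`; `Wd`'s
  leaf data displayed) of the same DEEP corner pairs — there μ = 0 makes Kato's divisibility at the twin integral, the only input of the converse half of `E`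
  besides the certificates (g18's cut, `…HybridTwinMuAnDeepCore` p640833); implied by 19948 (`twinMuAnDeep_of_twinMuAn`).
* (route file, not here) `KatoTwinFactsFiveAnContra` = the FIFTEEN twin ∕ MAX facts (RULING 56 ∕ 66 (e) text = r14–r18 slot 3 VERBATIM).

HONEST FRAMING: two `Prop` constants (restrictions of OPEN children of an open crux); NOTHING asserted; no named fact minted here, no theorem, no `sorry`; items 19065 ∕ 19946 ∕ 19948 stay open; no
census word, tier or label moves (T7); BSD is not advanced. Census (lane B corner5-p2 CENSUS-G9, `N ≤ 4·10¹⁰`): both deep children bite at 1 ∕ 2 430 corner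
pairs at `p = 5` (`J9t-73o125d-14`, `N = 5 112 322 880`, 5S4, `#Ш_an = 25`) and at 0 ∕ 57 at `p = 7`.
References: [McCallumLMS1991] §5 (p. 303), Cor. 5.6 (p. 310); [WZhang2014] Thm. 1.1 (shape); [Cha2005] Thm. 21, Rmk. 25; [GreenbergLNM1716] §1 Conj. 1.11
(p. 61); [Kato2004Asterisque] Thm. 12.4, §17.13 (pp. 279–280); [Mazur1978] Cor. 4.1; [SteinWuthrich2013] Thm. 6.1; [Wuthrich2014] Thm. 1, Prop. 21;
[FriedbergHoffstein1995] Thm. B; tree: `…NonSurjCornerBranchesDefs` (g6), `…HybridTwinMuAnDeep` (g18), `…NonSurjCornerKolyZShallow` (g14).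
-/

set_option autoImplicit false
set_option linter.dupNamespace false

noncomputable section

open scoped Classical NumberField MatrixGroups ModularForm

open CongruenceSubgroup WeierstrassCurve NumberField IsDedekindDomain Field
  Literature.NumberTheory.EllipticCurves
  Literature.NumberTheory.EllipticCurves.ModularForms
  Literature.NumberTheory.EllipticCurves.Rank1Residual
  Literature.NumberTheory.QuadraticFields.Quadratic
  Summit.BirchSwinnertonDyer.Rank1Residual
  Summit.BirchSwinnertonDyer.Rank1Residual.X11b.Three.Koly

namespace Summit.BirchSwinnertonDyer.BirchSwinnertonDyer.Theorems

/-! ### §1 The two DEEP children (restrictions of OPEN children; nothing asserted) -/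

/-- [crux child KolyZ-DEEP of item 19065 `NonSurjCorner`, SHAPE B] **Refined-Kolyvagin CERTIFICATES at the DEEP frames of the DEEP corner pairs**
(= r14–r18 slot 1 `stub_kolyZShaAnDeep57` VERBATIM; the `Ш_an`-cut of `NonSurjCornerKolyZ`). For every corner pair `(E,p)` (`ClassX11b`, `ρ̄_{E,p}`
not onto, `p ∈ {5,7}`, `p ∣ ord_p Δ_min`, no (ram) witness) whose analytic Ш is a rational `s` with `0 < ord_p s`, and every classical frame (`K` imaginary
quadratic, `|d_K| > 4`, Heegner for `N = N_E` and for `p`, a parametrisation `Dt` of level `N` with `p ∤ c(Dt)`, `β² ≡ d_K (mod 4N)`, `ι : K → ℂ`) that is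
DEEP (some conductor-1 Kolyvagin–Heegner datum's bottom point, read in `E(K)`, lies in `p^{t+1}E(K)`, `t = ord_p ∏_ℓ c_ℓ(E/ℚ)`): some level `M ≤ t`
carries `CertificateAt Dt β ι p M` (a square-free product `n` of Kolyvagin primes of index `≥ M+1` with `P_n ∉ p^{M+1}E(K[n])`). At shallow frames the
conductor-1 certificate is a theorem (`nonSurjCornerKolyZ_of_bottom_not_pow_divisible'`); off the deep pairs the converse half is trivial. OPEN class-wide
(Kolyvagin's refined conjecture at a non-surjective irreducible image with `p ∥ N`; W. Zhang 2014 needs `ρ̄` onto, `p ∤ N`, ♠). A `Prop` constant;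
nothing asserted. [cite: McCallumLMS1991, §5 (p. 303) and Cor. 5.6 (p. 310) (shape)] [cite: WZhang2014, Thm. 1.1 (shape; hypotheses NOT met)]
[cite: Cha2005, Thm. 21 and Rmk. 25 (the consumer)] -/
@[conjecture]
def NonSurjCornerKolyZDeep : Prop :=
  ∀ (W : WeierstrassCurve ℚ) [W.IsElliptic] [W.IsGloballyMinimal] (p : ℕ) [Fact p.Prime]
    (N : ℕ) [NeZero N] (K : Type) [Field K] [NumberField K]
    (Dt : ModularParametrizationData W N) (β : ℤ) (ι : K →+* ℂ),
    ClassX11b W p → ¬ Surj W p → (p = 5 ∨ p = 7) → p ∣ padicValInt p W.minimalDiscriminantInt →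
    ¬ Ram W p → (∃ s : ℚ, shaAn W = (s : ℂ) ∧ 0 < padicValRat p s) →
    W.conductorNorm ℤ = N → IsImaginaryQuadratic K →
    4 < (NumberField.discr K).natAbs → SatisfiesHeegnerHypothesis N K →
    SatisfiesHeegnerHypothesis p K → (4 * (N : ℤ)) ∣ β ^ 2 - NumberField.discr K → ¬ (p : ℤ) ∣ Dt.c →
    (∃ (d₁ : KolyvaginHeegnerData Dt β ι 1) (y : (W.baseChange K).toAffine.Point),
      WeierstrassCurve.Affine.Point.map (W' := W) (algebraMap K (ringClassField K ι 1)).toRatAlgHom y =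
        d₁.derivedPoint ∧
      ∃ Q : (W.baseChange K).toAffine.Point, ((p ^ (padicValNat p W.tamagawaProduct + 1) : ℕ) : ℤ) • Q = y) →
    ∃ M : ℕ, M ≤ padicValNat p W.tamagawaProduct ∧ CertificateAt Dt β ι p M

/-- [crux child TwinMuAn-DEEP of item 19065 `NonSurjCorner`, SHAPE B] **Analytic `μ = 0` at the Friedberg–Hoffstein twins of the DEEP corner pairs**
(= clause (2b) of r18's `stub_twinMuAnDeep57`, binder `hμD` of glue #20 VERBATIM; the `Ш_an`-cut of `NonSurjCornerTwinMuAn`). For every corner pair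
`(E,p)` as above with `#Ш(E)_an = s`, `0 < ord_p s`, every imaginary quadratic `K` satisfying the Heegner hypothesis for `N_E` with `L(E^{(d_K)},1) ≠ 0`,
and every globally minimal model `Wd = Cd • E^{(d_K)}` of the twist (then a non-surjective X11a leaf at `p` with `p ∣ ord_p Δ_min(Wd)` — displayed as
hypotheses): for every newform `f` of `Wd`, period ratio `ϖ` (`ϖ·Ω_{Wd} = Ω⁺_f`) and Mazur–Tate–Teitelbaum function `L` of `f` at `p` with allowable root
`a = ±1` (`IsMultPAdicLFunctionOf f p a L`), SOME coefficient of `ϖ·L` is a `p`-adic unit. There μ = 0 makes Kato's divisibility at the twin integral — the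
twin's Euler half, the only input of the converse half of `E` besides the certificates; off the deep pairs it is idle (`…HybridTwinMuAnDeepCore`). OPEN
class-wide (Greenberg's Conj. 1.11 at a non-surjective irreducible image); per ρ̄-class decidable (EPW). A `Prop` constant; nothing asserted.
[cite: GreenbergLNM1716, §1 Conj. 1.11 (p. 61) (shape)] [cite: Kato2004Asterisque, Thm. 12.4 (the consumer)] [cite: Wuthrich2014, Cor. 18] -/
@[conjecture]
def NonSurjCornerTwinMuAnDeep : Prop :=
  ∀ (W : WeierstrassCurve ℚ) [W.IsElliptic] [W.IsGloballyMinimal] (p : ℕ) [Fact p.Prime],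
    ClassX11b W p → ¬ Surj W p → (p = 5 ∨ p = 7) → p ∣ padicValInt p W.minimalDiscriminantInt →
    ¬ Ram W p → (∃ s : ℚ, shaAn W = (s : ℂ) ∧ 0 < padicValRat p s) →
    ∀ (K : Type) [Field K] [NumberField K] (Wd : WeierstrassCurve ℚ) [Wd.IsElliptic] [Wd.IsGloballyMinimal]
      (Cd : VariableChange ℚ),
      IsImaginaryQuadratic K → SatisfiesHeegnerHypothesis (W.conductorNorm ℤ) K →
      (W.quadraticTwist (NumberField.discr K : ℚ)).entireLFunction 1 ≠ 0 →
      Cd • W.quadraticTwist (NumberField.discr K : ℚ) = Wd →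
      ClassX11a Wd p → ¬ Surj Wd p → p ∣ padicValInt p Wd.minimalDiscriminantInt →
      ∀ {N : ℕ} [NeZero N] (f : CuspForm (Gamma0 N) 2), IsNewformOf Wd f →
      ∀ (ϖ : ℚ), (ϖ : ℝ) * Wd.realPeriodRat = plusPeriod f →
      ∀ (a : ℚ_[p]) (L : PowerSeries ℚ_[p]),
        (Wd.HasSplitMultiplicativeReductionAtPrime p → a = 1) →
        (¬ Wd.HasSplitMultiplicativeReductionAtPrime p → a = -1) →
        IsMultPAdicLFunctionOf f p a L →
        ∃ n : ℕ, ‖PowerSeries.coeff n (PowerSeries.C ((ϖ : ℚ) : ℚ_[p]) * L)‖ = 1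

end Summit.BirchSwinnertonDyer.BirchSwinnertonDyer.Theorems

end
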